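import Mathlib
import Summits.PneNP.PneNP.Theorems.PositionalGamesMpgHardNpLanguageDefs

/-!
# Route PositionalGames — support item `MpgHardNpLanguage` (stmt-PneNP-1300): guessed ripple-carry arithmetic on bit rows

Theorem file for the definitions `carrySeq`, `carryRow`, `sumRow`, `AddOK`, `natRow` of
`…Defs.lean` (proof of `Summit.PneNP.PneNP.Theses.PositionalGames.MpgHardNpLanguage`). In the
`∃SO` certificate for mean-payoff games the numbers (shifted potentials, `φ(u) + 2ⁿ`,
`φ(u) + 2·w(u)`, differences) are BIT ROWS `Fin m → Bool` indexed by the universe of the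
finite structure (little-endian, value `Nat.ofBits`), and every addition is certified by a guessed
carry row checked position by position (Vollmer 1999, §1.1: `sⱼ = aⱼ ⊕ bⱼ ⊕ cⱼ`, `cⱼ₊₁ = MAJ(aⱼ,bⱼ,cⱼ)`).

* `ripple_val` — the value identity of a ripple-carry transcript with carries `Fin (m+1) → Bool`;
* `AddOK.ofBits_eq` (soundness: `⟦S⟧ = ⟦A⟧ + ⟦B⟧`) and `addOK_sumRow_carryRow` (completeness:
  the school addition is a transcript whenever `⟦A⟧ + ⟦B⟧ < 2^m`);
* `ofBits_natRow(_of_lt)`, `ofBits_eq_sum_ite` (rows with equal values are equal by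
  `ArithCkt.funext_of_ofBits_eq`);
* `eq_faSum_iff`, `eq_faCarry_iff`, `faCarry_eq_false_iff` — the full adder as propositional
  formulas in the atoms `· = true` (the shape in which the first-order sentence states it).

Reuses `ArithCkt.faSum/faCarry/fa_spec` (`CircuitAdderMultiplier.lean`) and Batteries' `Nat.ofBits`.
-/

namespace Summit.PneNP.PneNP.Theorems.MpgNP

set_option linter.dupNamespace false -- `Summit.PneNP.PneNP.…`: summit = sub-problem (D-0017)

open Literature.Computability.Complexity.ArithCkt

/-- **Value identity of a ripple-carry transcript** (carries indexed by `Fin (m+1)`, position `0`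
the carry-in, position `m` the carry-out): `⟦S⟧ + 2^m·c_out = ⟦A⟧ + ⟦B⟧ + c_in`.
[cite: Vollmer1999, §1.1] -/
theorem ripple_val : ∀ {m : ℕ} (A B S : Fin m → Bool) (C : Fin (m + 1) → Bool),
    (∀ j : Fin m, S j = faSum (A j) (B j) (C j.castSucc)) →
    (∀ j : Fin m, C j.succ = faCarry (A j) (B j) (C j.castSucc)) →
    Nat.ofBits S + 2 ^ m * (C (Fin.last m)).toNat = Nat.ofBits A + Nat.ofBits B + (C 0).toNat := by
  intro m
  induction m with
  | zero =>
    intro A B S C _ _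
    simp [Nat.ofBits_zero]
  | succ m ih =>
    intro A B S C hS hC
    have ih' := ih (A ∘ Fin.succ) (B ∘ Fin.succ) (S ∘ Fin.succ) (C ∘ Fin.succ)
      (fun j => by simpa using hS j.succ) (fun j => by simpa using hC j.succ)
    simp only [Function.comp_apply, Fin.succ_last, Fin.succ_zero_eq_one] at ih'
    have h0 := fa_spec (A 0) (B 0) (C 0)
    have hS0 : S 0 = faSum (A 0) (B 0) (C 0) := hS 0
    have hC1 : C 1 = faCarry (A 0) (B 0) (C 0) := hC 0
    rw [Nat.ofBits_succ S, Nat.ofBits_succ A, Nat.ofBits_succ B, pow_succ]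
    rw [← hS0, ← hC1] at h0
    have e1 : 2 * Nat.ofBits (S ∘ Fin.succ) + (S 0).toNat + 2 ^ m * 2 * (C (Fin.last (m + 1))).toNat
        = 2 * (Nat.ofBits (S ∘ Fin.succ) + 2 ^ m * (C (Fin.last (m + 1))).toNat) + (S 0).toNat := by
      ring
    rw [e1, ih']
    omega

/-- **Soundness of the transcript**: `⟦S⟧ = ⟦A⟧ + ⟦B⟧`. [cite: Vollmer1999, §1.1] -/
theorem AddOK.ofBits_eq {m : ℕ} {A B S C : Fin m → Bool} (h : AddOK A B S C) :
    Nat.ofBits S = Nat.ofBits A + Nat.ofBits B := by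
  obtain ⟨h0, hS, hC, htop⟩ := h
  -- extend the carries by the (vanishing) carry out of the top position
  let C' : Fin (m + 1) → Bool := Fin.snoc (α := fun _ => Bool) C false
  have hcs : ∀ j : Fin m, C' j.castSucc = C j := fun j => by simp [C']
  have hlast : C' (Fin.last m) = false := by simp [C']
  have hval := ripple_val A B S C' (fun j => by rw [hcs]; exact hS j)
    (fun j => by
      rw [hcs]
      by_cases hj : (j : ℕ) + 1 = m
      · have : j.succ = Fin.last m := Fin.ext (by simp [hj])
        rw [this, hlast, htop j hj]
      · have hlt : (j : ℕ) + 1 < m := by omega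
        have e : j.succ = (⟨(j : ℕ) + 1, hlt⟩ : Fin m).castSucc := Fin.ext rfl
        rw [e, hcs]
        exact hC j ⟨(j : ℕ) + 1, hlt⟩ rfl)
  have hzero : (C' 0).toNat = 0 := by
    rcases Nat.eq_zero_or_pos m with rfl | hm
    · rfl
    · have e : (0 : Fin (m + 1)) = (⟨0, hm⟩ : Fin m).castSucc := Fin.ext rfl
      rw [e, hcs, h0 ⟨0, hm⟩ rfl]
      rfl
  rw [hlast, hzero] at hval
  simpa using hval

/-- **Completeness of the transcript**: if `⟦A⟧ + ⟦B⟧ < 2^m` then the school addition's sum and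
carry rows satisfy `AddOK`. [cite: Vollmer1999, §1.1] -/
theorem addOK_sumRow_carryRow {m : ℕ} (A B : Fin m → Bool) (h : Nat.ofBits A + Nat.ofBits B < 2 ^ m) :
    AddOK A B (sumRow A B) (carryRow A B) := by
  let C' : Fin (m + 1) → Bool := fun j => carrySeq A B j
  have hCsucc : ∀ j : Fin m, C' j.succ = faCarry (A j) (B j) (C' j.castSucc) := fun j => by
    show carrySeq A B ((j : ℕ) + 1) = faCarry (A j) (B j) (carrySeq A B j)
    rw [carrySeq, dif_pos j.isLt]
  have hval := ripple_val A B (sumRow A B) C' (fun j => rfl) hCsucc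
  have h0 : (C' 0).toNat = 0 := rfl
  rw [h0, add_zero] at hval
  have htop : C' (Fin.last m) = false := by
    by_contra hne
    rw [Bool.not_eq_false] at hne
    rw [hne] at hval
    simp at hval
    omega
  refine ⟨fun j hj => ?_, fun j => rfl, fun j j' hjj' => ?_, fun j hj => ?_⟩
  · show carrySeq A B j = false
    rw [hj]; rfl
  · have := hCsucc j
    have e : C' j.succ = carryRow A B j' := by
      show carrySeq A B ((j : ℕ) + 1) = carrySeq A B j'
      rw [hjj']
    rw [e] at this
    exact this
  · have := hCsucc j
    have e : j.succ = Fin.last m := Fin.ext (by simp [hj])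
    rw [e, htop] at this
    exact this.symm

/-- The row of `a` has value `a mod 2^m`. [folklore] -/
theorem ofBits_natRow (m a : ℕ) : Nat.ofBits (natRow m a) = a % 2 ^ m :=
  Nat.ofBits_testBit a m

/-- The row of `a < 2^m` has value `a`. [folklore] -/
theorem ofBits_natRow_of_lt {m a : ℕ} (h : a < 2 ^ m) : Nat.ofBits (natRow m a) = a := by
  rw [ofBits_natRow, Nat.mod_eq_of_lt h]

/-- The value of a row as the sum `Σⱼ [rⱼ]·2ʲ` written with `if` (the shape of the route's inline
weight `Σⱼ if x(u,j) then 2ʲ else 0`). [folklore] -/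
theorem ofBits_eq_sum_ite {m : ℕ} (r : Fin m → Bool) :
    Nat.ofBits r = ∑ j : Fin m, if r j = true then 2 ^ (j : ℕ) else 0 := by
  rw [Literature.Computability.AlgebraicComplexity.BoolGadgets.ofBits_eq_sum]
  refine Finset.sum_congr rfl fun j _ => ?_
  cases r j <;> simp

/-- The full-adder SUM bit as a propositional formula in the atoms: `s = a ⊕ b ⊕ c` iff
`(s ↔ ((a ↔ b) ↔ c))`. [cite: Vollmer1999, §1.1] -/
theorem eq_faSum_iff (s a b c : Bool) :
    s = faSum a b c ↔ (s = true ↔ ((a = true ↔ b = true) ↔ c = true)) := by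
  cases s <;> cases a <;> cases b <;> cases c <;> decide

/-- The full-adder CARRY bit as a propositional formula in the atoms: `c' = MAJ(a,b,c)` iff
`(c' ↔ (a ∧ b) ∨ (c ∧ ¬(a ↔ b)))`. [cite: Vollmer1999, §1.1] -/
theorem eq_faCarry_iff (c' a b c : Bool) :
    c' = faCarry a b c ↔ (c' = true ↔ ((a = true ∧ b = true) ∨ (c = true ∧ ¬ (a = true ↔ b = true)))) := by
  cases c' <;> cases a <;> cases b <;> cases c <;> decide

/-- No carry: `MAJ(a,b,c) = false` iff `¬((a ∧ b) ∨ (c ∧ ¬(a ↔ b)))`. [cite: Vollmer1999, §1.1] -/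
theorem faCarry_eq_false_iff (a b c : Bool) :
    faCarry a b c = false ↔ ¬ ((a = true ∧ b = true) ∨ (c = true ∧ ¬ (a = true ↔ b = true))) := by
  cases a <;> cases b <;> cases c <;> decide
end Summit.PneNP.PneNP.Theorems.MpgNP
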